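import Literature.NumberTheory.EllipticCurves.ZpExtensionGaloisTwistRestrict
import Literature.NumberTheory.EllipticCurves.ZpExtensionUnramifiedProofs
import Literature.NumberTheory.EllipticCurves.GoodReductionUnramifiedProofs
import HarnessLib

/-!
# `E[p^J](χ_u)` is unramified at every good place `v ∤ p` (Néron–Ogg–Shafarevich + `K_∞/K` unramified outside `p`)

For the unit twist `E[p^J](χ_u) = W.twistedTorsionGaloisModule p κ J u hu` (file
`ZpExtensionGaloisTwistRestrict.lean`; `χ_u(σ) = u^{κ(σ) mod p^J}` factors through `Gal(K_∞/K)`): at a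
finite place `v ∤ p` of good reduction the inertia groups `I_𝔓 ≤ Γ_K` (`𝔓 ∣ v`) act trivially — on
`E[p^J]` by the criterion of Néron–Ogg–Shafarevich (Silverman VII.4.1(a), tree
`smul_geomTorsion_eq_of_mem_inertia`), and through `χ_u` because a `ℤ_p`-extension is unramified outside `p`
(Washington Prop. 13.2, tree `ZpExtension.inertia_le_kerSubgroup_holds`: `I_𝔓 ≤ ker κ`). This is the
hypothesis «`S` contains the ramified places of `M`» of the tree's Poitou–Tate fact
`poitouTate_selmerStructure_duality` (`GaloisRep.IsUnramifiedAt`) for `M = E[p^J](χ_u)` and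
`S = S₀ ∪ {v ∣ p} ∪ ∞`, `S₀ ⊇` bad places (twisted Poitou–Tate lifting, cell `bsd-2adic` ADDENDUM-16 (β)).
THEOREMS ONLY.

References: [SilvermanAEC2009] Prop. VII.4.1(a); [Washington1997] Prop. 13.2; [GreenbergLNM1716] §4 p. 124.
-/

noncomputable section

open scoped Classical

universe u

namespace WeierstrassCurve

open NumberField IsDedekindDomain Field Literature.NumberTheory.EllipticCurves
  Literature.NumberTheory.GaloisRepresentations

variable {K : Type u} [Field K] [NumberField K] (W : WeierstrassCurve K) [W.IsElliptic] (p : ℕ)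
  [Fact p.Prime] (κ : ZpExtension K p) (J : ℕ) (u : ℤ) (hu : (p : ℤ) ∣ u - 1)

/-- **`E[p^J](χ_u)` is unramified at a good place `v ∤ p`**: every `τ ∈ I_𝔓`, `𝔓 ∣ v`, lies in `ker κ`
(`ZpExtension.inertia_le_kerSubgroup_holds`, Washington 13.2), so acts through `E[p^J]`, where it acts
trivially (Néron–Ogg–Shafarevich, `smul_geomTorsion_eq_of_mem_inertia`).
[cite: SilvermanAEC2009, Prop. VII.4.1(a)] [cite: Washington1997, Prop. 13.2] -/
theorem isUnramifiedAt_twistedTorsionGaloisModule {v : HeightOneSpectrum (𝓞 K)}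
    (hv : W.HasGoodReductionAt v) (hpv : ((p : ℕ) : 𝓞 K) ∉ v.asIdeal) :
    GaloisRep.IsUnramifiedAt v (W.twistedTorsionGaloisModule p κ J u hu) := by
  intro 𝔓 h𝔓 τ hτ
  have hτk : τ ∈ κ.kerSubgroup := ZpExtension.inertia_le_kerSubgroup_holds K p κ hpv h𝔓 hτ
  have hn : ((((p ^ J : ℕ) : ℤ) : 𝓞 K)) ∉ v.asIdeal := fun h ↦ hpv <| by
    rw [Int.cast_natCast, Nat.cast_pow] at h
    exact v.isPrime.mem_of_pow_mem J h
  refine LinearMap.ext fun P ↦ ?_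
  change W.twistedTorsionGaloisModule p κ J u hu τ P = P
  rw [ZpExtension.galoisTwist_apply_of_mem_kerSubgroup _ _ _ _ _ _ hτk, torsionGaloisModule_apply_apply]
  exact W.smul_geomTorsion_eq_of_mem_inertia hv hn h𝔓 hτ P

/-- Hence outside `S₀ ∪ {v ∣ p}`, when `W` has good reduction at every `v ∉ S₀` with `v ∤ p` (the
hypothesis `hbad` of the generic lifting `LIFT`), `E[p^J](χ_u)` is unramified — the form consumed by
`SelmerComplement` / `UnramifiedOrthogonal` (`∀ v, Sum.inr v ∉ S → p^J ∉ v ∧ IsUnramifiedAt v`).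
[cite: SilvermanAEC2009, Prop. VII.4.1(a)] [cite: Washington1997, Prop. 13.2] -/
theorem natCast_pow_not_mem_and_isUnramifiedAt_twistedTorsionGaloisModule
    {S₀ : Set (HeightOneSpectrum (𝓞 K))}
    (hbad : ∀ v : HeightOneSpectrum (𝓞 K), v ∉ S₀ → ((p : ℕ) : 𝓞 K) ∉ v.asIdeal →
      W.HasGoodReductionAt v)
    {v : HeightOneSpectrum (𝓞 K)} (hvS : v ∉ S₀) (hpv : ((p : ℕ) : 𝓞 K) ∉ v.asIdeal) :
    ((p ^ J : ℕ) : 𝓞 K) ∉ v.asIdeal ∧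
      GaloisRep.IsUnramifiedAt v (W.twistedTorsionGaloisModule p κ J u hu) := by
  refine ⟨fun h ↦ hpv ?_, W.isUnramifiedAt_twistedTorsionGaloisModule p κ J u hu (hbad v hvS hpv) hpv⟩
  rw [Nat.cast_pow] at h
  exact v.isPrime.mem_of_pow_mem J h

end WeierstrassCurve

end
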